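import Literature.Computability.Cryptography.BLPRSSection4Assembly
import HarnessLib

/-!
# BLPRS 2013, §3–§4 at the level of laws, for a test CLOSE to the rate-guess test (what a finite-precision machine runs)

Topic `Computability/Cryptography` (LWE), grouping namespace `BLPRS2013`; sequel of `BLPRSSection4Assembly.lean`
(`section4_three_candidates`, `section4_selected`: Thm. 4.1's bookkeeping and the selection, for the IDEAL rate-guess test
`A = flatGuessTest K … (rateGuessKernel …) U …`). A coin-driven machine does not run `A` but a test `A'` whose kernels and
reference blocks are within negligible statistical distance of the ideal ones (`LWERateGuessPerturb.lean`:
`|Pr[A'(P)] - Pr[A(P)]| ≤ ν` on EVERY input law `P`). Thm. 4.1's bookkeeping applies to `A'` verbatim, and its gap on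
`(H₀, U)` is that of `A` minus `2ν`; this file records the two statements with `A'` and `ν` (everything PROVED, no
definition, no named fact):

* **`section4_three_candidates_of_close`** — `m(Adv E₁' + ℓ) + Adv E₂' + m(Adv E₃' + ℓ) ≥ 1 - err - 2ν - Δ_LHL` for the three
  candidates built by Thm. 4.1 from `A'`;
* **`section4_selected_of_close`** — the selected test (ideal selection stage) has advantage `≥ η⋆/2 - 2·3·32/(N_sel η⋆²)`
  whenever `η⋆ ≤ (1 - err - 2ν - Δ_LHL - 2mℓ)/(2m+1) - m/(2Qα₂)`.

## References

* Z. Brakerski, A. Langlois, C. Peikert, O. Regev, D. Stehlé, *Classical hardness of learning with errors*, STOC 2013;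
  arXiv:1306.0281, Thm. 4.1 (proof), Cor. 3.2, Lemma 2.15, p. 13 and §5 (finite precision). [BrakerskiEtAl2013]
* O. Regev, *On lattices, learning with errors …*, J. ACM 56 (2009), Lemma 4.1. [RegevLWE2009]
-/

noncomputable section

open MeasureTheory Literature.Algebra.EuclideanLattices Literature.Probability.Distributions
open scoped Real ENNReal

namespace Literature.Computability.Cryptography

namespace BLPRS2013

open LWE LWE.MP12

section Close

variable {n Q q' d : ℕ} [NeZero Q] [NeZero q'] {r B : ℝ} {G : ℕ} {τ : Fin G → ℝ} {m₃ N N' mfel : ℕ} {θ : ℝ}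

/-- **§3–§4 for a test `ν`-close to the rate-guess test** (Lemma 4.7 as hypothesis): as `section4_three_candidates`,
with the three candidates built by Thm. 4.1 from `A'` and the bound weakened by `2ν`.
[cite: BrakerskiEtAl2013, Thm. 4.1 (proof) with Cor. 3.2, Lemma 2.15, p. 13 and §5] -/
theorem section4_three_candidates_of_close {ε α₀ η₀ L47 ν : ℝ} (hn : 0 < n) (hε : 0 < ε) (hε' : ε ≤ 1 / 2)
    (hr : max (Q : ℝ)⁻¹ (q' : ℝ)⁻¹ * Real.sqrt (2 * Real.log (2 * n * (1 + 1 / ε)) / π) ≤ r) (hα₀ : 0 < α₀)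
    (hG : 0 < G) (hN : 0 < N) (hN' : 0 < N') (hm₃ : 0 < m₃) (hθ : 0 < θ)
    (K : (Fin m₃ → (Fin n → ZMod q') × ZMod q') → PMF Bool)
    (A' : Distinguisher (Fin n) (ZMod Q) (G * (N * m₃)))
    (hA' : ∀ P : PMF (Fin (G * (N * m₃)) → (Fin n → ZMod Q) × ZMod Q),
      |(acceptProb A' P).toReal -
        (acceptProb (flatGuessTest K N m₃ (rateGuessKernel n Q q' r B τ m₃) (uniformSamples (Fin n) (ZMod q') m₃) N' θ) P).toReal| ≤ ν)
    (χsrc χh : PMF (ZMod Q)) (χN : PMF (Fin n → ℤ)) (ρ₀ : (Fin n → ZMod Q) → ℝ) (ζ : PMF (Fin n → ℤ))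
    (hζ : ∀ z ∈ ζ.support, ∀ i, z i = 0 ∨ z i = 1)
    (hnoise : ∀ z ∈ ζ.support, (noiseH₁ χN χh (intCastVec z : Fin n → ZMod Q)).tvDist (discretizedGaussian Q (ρ₀ (intCastVec z))) ≤ η₀)
    (hζ' : ∀ z ∈ ζ.support, ‖intVecToEuclidean n z‖ ≤ B ∧ α₀ ≤ ρ₀ (intCastVec z) ∧
      ∃ w : Fin G, 4 * θ ≤ distinguishingAdvantage (discretizedGaussian q'
        (Real.sqrt (Real.sqrt (ρ₀ (intCastVec z) ^ 2 + r ^ 2 * (‖intVecToEuclidean n z‖ ^ 2 + B ^ 2)) ^ 2 + τ w ^ 2))) m₃ K)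
    (hεθ : m₃ * (4 * ε) ≤ θ / 2) (hQθ : m₃ * (2 / (α₀ * Q) + 10 * ε) + m₃ * η₀ ≤ 2 * θ)
    (h47 : ∀ ζ' : PMF (Fin n → ℤ), (∀ z ∈ ζ'.support, ∀ i, z i = 0 ∨ z i = 1) →
      ∀ D : (Fin n → ℤ) × (Matrix (Fin (d + 1)) (Fin n) (ZMod Q) × (Fin 1 → (Fin n → ZMod Q) × ℤ)) → PMF Bool,
        ∃ D' : ((Fin (d + 1) → ZMod Q) × ZMod Q) × (Fin mfel → (Fin (d + 1) → ZMod Q) × ZMod Q) → PMF Bool,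
          extLWEAdvantageZ ζ' χN 1 D ≤ felAdvantage χsrc mfel D' + L47) :
    ∃ (E₁ E₃ : Distinguisher (Fin d) (ZMod Q) mfel) (E₂ : Distinguisher (Fin d) (ZMod Q) (G * (N * m₃))),
      1 - ((G + 1) * (4 / (N * θ ^ 2)) + 8 / (N' * θ ^ 2)) - 2 * ν -
          (lawCz (d + 1) ζ).tvDist (PMF.uniformOfFintype (Matrix (Fin (d + 1)) (Fin n) (ZMod Q) × (Fin (d + 1) → ZMod Q))) ≤
        (G * (N * m₃) : ℕ) * (distinguishingAdvantage χsrc mfel E₁ + ∑ p ∈ Q.primeFactors, ((p : ℝ) ^ (d + 1))⁻¹ + L47) +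
          distinguishingAdvantage χh (G * (N * m₃)) E₂ +
          (G * (N * m₃) : ℕ) * (distinguishingAdvantage χsrc mfel E₃ + ∑ p ∈ Q.primeFactors, ((p : ℝ) ^ (d + 1))⁻¹ + L47) := by
  haveI : NeZero (G * (N * m₃)) := ⟨(Nat.mul_pos hG (Nat.mul_pos hN hm₃)).ne'⟩
  set A := flatGuessTest K N m₃ (rateGuessKernel n Q q' r B τ m₃) (uniformSamples (Fin n) (ZMod q') m₃) N' θ with hA
  -- Thm. 4.1's bookkeeping for `A'`, with `χ₀ := noiseH₁ χN χh` (so `η = 0`)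
  obtain ⟨E₁, E₃, E₂, hbound⟩ := blprs_theorem_4_1_bound (k := d) (fun s => noiseH₁ χN χh s) χsrc χh χN (G * (N * m₃)) mfel ζ hζ
    (η := 0) (L47 := L47) (fun z => by rw [PMF.tvDist_self]) h47 A'
  -- the IDEAL rate-guess test's advantage against `H₀`, transferred to `A'`
  have hadv := advantage_rateGuess_hybridH₀' (r := r) (B := B) (τ := τ) (N := N) (N' := N') hn hε hε' hr hα₀ hN hN' hθ K
    (fun s => noiseH₁ χN χh s) ρ₀ ζ (fun z hz => ?_) hεθ hQθ
  · refine ⟨E₁, E₃, E₂, ?_⟩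
    rw [mul_zero, zero_add] at hbound
    rw [← hA] at hadv
    have h₁ := hA' (hybridH₀ (fun s => noiseH₁ χN χh s) (G * (N * m₃)) ζ)
    have h₂ := hA' (uniformSamples (Fin n) (ZMod Q) (G * (N * m₃)))
    rw [abs_le] at h₁ h₂
    have hle := le_abs_self ((acceptProb A' (hybridH₀ (fun s => noiseH₁ χN χh s) (G * (N * m₃)) ζ)).toReal -
      (acceptProb A' (uniformSamples (Fin n) (ZMod Q) (G * (N * m₃)))).toReal)
    linarith [h₁.1, h₁.2, h₂.1, h₂.2]
  · obtain ⟨hB, hρ, w, hw⟩ := hζ' z hz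
    exact ⟨hB, hρ, hnoise z hz, w, hw⟩

/-- **… and the selection** (ideal selection stage): as `section4_selected`, for the test `A'`, with the threshold inequality
weakened by `2ν`. [cite: BrakerskiEtAl2013, Thm. 4.1 (proof), Cor. 3.2, Lemma 2.15, p. 13 and §5; RegevLWE2009, Lemma 4.1] -/
theorem section4_selected_of_close {ε α₀ α₂ u η₀ L47 ν : ℝ} (Nsel : ℕ) (hn : 0 < n) (hε : 0 < ε) (hε' : ε ≤ 1 / 2)
    (hr : max (Q : ℝ)⁻¹ (q' : ℝ)⁻¹ * Real.sqrt (2 * Real.log (2 * n * (1 + 1 / ε)) / π) ≤ r) (hα₀ : 0 < α₀) (hα₂ : 0 < α₂)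
    (hG : 0 < G) (hN : 0 < N) (hN' : 0 < N') (hm₃ : 0 < m₃) (hθ : 0 < θ) (hNsel : 0 < Nsel)
    (K : (Fin m₃ → (Fin n → ZMod q') × ZMod q') → PMF Bool)
    (A' : Distinguisher (Fin n) (ZMod Q) (G * (N * m₃)))
    (hA' : ∀ P : PMF (Fin (G * (N * m₃)) → (Fin n → ZMod Q) × ZMod Q),
      |(acceptProb A' P).toReal -
        (acceptProb (flatGuessTest K N m₃ (rateGuessKernel n Q q' r B τ m₃) (uniformSamples (Fin n) (ZMod q') m₃) N' θ) P).toReal| ≤ ν)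
    (χN : PMF (Fin n → ℤ)) (ρ₀ : (Fin n → ZMod Q) → ℝ) (ζ : PMF (Fin n → ℤ))
    (hζ : ∀ z ∈ ζ.support, ∀ i, z i = 0 ∨ z i = 1)
    (hnoise : ∀ z ∈ ζ.support, (noiseH₁ χN (discretizedGaussian Q (Real.sqrt (α₂ ^ 2 + u ^ 2))) (intCastVec z : Fin n → ZMod Q)).tvDist
      (discretizedGaussian Q (ρ₀ (intCastVec z))) ≤ η₀)
    (hζ' : ∀ z ∈ ζ.support, ‖intVecToEuclidean n z‖ ≤ B ∧ α₀ ≤ ρ₀ (intCastVec z) ∧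
      ∃ w : Fin G, 4 * θ ≤ distinguishingAdvantage (discretizedGaussian q'
        (Real.sqrt (Real.sqrt (ρ₀ (intCastVec z) ^ 2 + r ^ 2 * (‖intVecToEuclidean n z‖ ^ 2 + B ^ 2)) ^ 2 + τ w ^ 2))) m₃ K)
    (hεθ : m₃ * (4 * ε) ≤ θ / 2) (hQθ : m₃ * (2 / (α₀ * Q) + 10 * ε) + m₃ * η₀ ≤ 2 * θ)
    (h47 : ∀ ζ' : PMF (Fin n → ℤ), (∀ z ∈ ζ'.support, ∀ i, z i = 0 ∨ z i = 1) →
      ∀ D : (Fin n → ℤ) × (Matrix (Fin (d + 1)) (Fin n) (ZMod Q) × (Fin 1 → (Fin n → ZMod Q) × ℤ)) → PMF Bool,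
        ∃ D' : ((Fin (d + 1) → ZMod Q) × ZMod Q) × (Fin mfel → (Fin (d + 1) → ZMod Q) × ZMod Q) → PMF Bool,
          extLWEAdvantageZ ζ' χN 1 D ≤ felAdvantage (discretizedGaussian Q α₂) mfel D' + L47)
    {ηstar : ℝ} (hηstar : 0 < ηstar)
    (hη : ηstar ≤ (1 - ((G + 1) * (4 / (N * θ ^ 2)) + 8 / (N' * θ ^ 2)) - 2 * ν -
          (lawCz (d + 1) ζ).tvDist (PMF.uniformOfFintype (Matrix (Fin (d + 1)) (Fin n) (ZMod Q) × (Fin (d + 1) → ZMod Q))) -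
          2 * (G * (N * m₃) : ℕ) * (∑ p ∈ Q.primeFactors, ((p : ℝ) ^ (d + 1))⁻¹ + L47)) / (2 * (G * (N * m₃) : ℕ) + 1) -
        (G * (N * m₃) : ℕ) * (1 / (2 * Q * α₂))) :
    ∃ D : Distinguisher (Fin d) (ZMod Q) (max (G * (N * m₃)) mfel),
      ηstar / 2 - 2 * ((2 + 1 : ℕ) * (32 / (Nsel * ηstar ^ 2))) ≤
        distinguishingAdvantage (discretizedGaussian Q α₂) (max (G * (N * m₃)) mfel) D := by
  obtain ⟨E₁, E₃, E₂, hsum⟩ := section4_three_candidates_of_close (τ := τ) hn hε hε' hr hα₀ hG hN hN' hm₃ hθ K A' hA'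
    (discretizedGaussian Q α₂) (discretizedGaussian Q (Real.sqrt (α₂ ^ 2 + u ^ 2))) χN ρ₀ ζ hζ hnoise hζ' hεθ hQθ h47
  have hmM : G * (N * m₃) ≤ max (G * (N * m₃)) mfel := le_max_left _ _
  have hfM : mfel ≤ max (G * (N * m₃)) mfel := le_max_right _ _
  have hA₁ : distinguishingAdvantage (discretizedGaussian Q α₂) (max (G * (N * m₃)) mfel) (padThen hfM E₁) =
      distinguishingAdvantage (discretizedGaussian Q α₂) mfel E₁ :=
    distinguishingAdvantage_padThen _ hfM E₁
  have hA₃ : distinguishingAdvantage (discretizedGaussian Q α₂) (max (G * (N * m₃)) mfel) (padThen hfM E₃) =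
      distinguishingAdvantage (discretizedGaussian Q α₂) mfel E₃ :=
    distinguishingAdvantage_padThen _ hfM E₃
  have hA₂ : distinguishingAdvantage (discretizedGaussian Q (Real.sqrt (α₂ ^ 2 + u ^ 2))) (G * (N * m₃)) E₂ - (G * (N * m₃) : ℕ) * (1 / (2 * Q * α₂)) ≤
      distinguishingAdvantage (discretizedGaussian Q α₂) (max (G * (N * m₃)) mfel) (raiseThen (discretizedGaussian Q u) (max (G * (N * m₃)) mfel) (padThen hmM E₂)) := by
    have hC₂' : distinguishingAdvantage (discretizedGaussian Q α₂) (max (G * (N * m₃)) mfel) (raiseThen (discretizedGaussian Q u) (max (G * (N * m₃)) mfel) (padThen hmM E₂)) =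
        distinguishingAdvantage (addConv (discretizedGaussian Q α₂) (discretizedGaussian Q u)) (G * (N * m₃)) E₂ := by
      rw [distinguishingAdvantage_raiseThen, distinguishingAdvantage_padThen]
    have habs := abs_distinguishingAdvantage_sub_le (ι := Fin d) (addConv (discretizedGaussian Q α₂) (discretizedGaussian Q u))
      (discretizedGaussian Q (Real.sqrt (α₂ ^ 2 + u ^ 2))) (G * (N * m₃)) E₂
    have htv := tvDist_addConv_discretizedGaussian_le Q hα₂ u
    rw [abs_le] at habs
    rw [hC₂']
    nlinarith [habs.1, mul_le_mul_of_nonneg_left htv (Nat.cast_nonneg (G * (N * m₃)))]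
  have hsum' : 1 - ((G + 1) * (4 / (N * θ ^ 2)) + 8 / (N' * θ ^ 2)) - 2 * ν -
        (lawCz (d + 1) ζ).tvDist (PMF.uniformOfFintype (Matrix (Fin (d + 1)) (Fin n) (ZMod Q) × (Fin (d + 1) → ZMod Q))) ≤
      ((G * (N * m₃) : ℕ) : ℝ) * (distinguishingAdvantage (discretizedGaussian Q α₂) mfel E₁ +
          (∑ p ∈ Q.primeFactors, ((p : ℝ) ^ (d + 1))⁻¹ + L47)) +
        distinguishingAdvantage (discretizedGaussian Q (Real.sqrt (α₂ ^ 2 + u ^ 2))) (G * (N * m₃)) E₂ +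
        ((G * (N * m₃) : ℕ) : ℝ) * (distinguishingAdvantage (discretizedGaussian Q α₂) mfel E₃ +
          (∑ p ∈ Q.primeFactors, ((p : ℝ) ^ (d + 1))⁻¹ + L47)) := by
    linarith [hsum]
  have hcases := exists_ge_of_weighted_sum_ge (x₁ := distinguishingAdvantage (discretizedGaussian Q α₂) mfel E₁)
    (x₂ := distinguishingAdvantage (discretizedGaussian Q (Real.sqrt (α₂ ^ 2 + u ^ 2))) (G * (N * m₃)) E₂)
    (x₃ := distinguishingAdvantage (discretizedGaussian Q α₂) mfel E₃)
    (ℓ := ∑ p ∈ Q.primeFactors, ((p : ℝ) ^ (d + 1))⁻¹ + L47) (Nat.cast_nonneg (G * (N * m₃))) hsum'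
  have hraise0 : 0 ≤ ((G * (N * m₃) : ℕ) : ℝ) * (1 / (2 * Q * α₂)) := by
    have hQ : (0 : ℝ) < Q := by exact_mod_cast Nat.pos_of_ne_zero (NeZero.ne Q)
    positivity
  set E : Fin (2 + 1) → Distinguisher (Fin d) (ZMod Q) (max (G * (N * m₃)) mfel) :=
    ![padThen hfM E₁, raiseThen (discretizedGaussian Q u) (max (G * (N * m₃)) mfel) (padThen hmM E₂), padThen hfM E₃] with hE
  have hbest : ∃ i, ηstar ≤ distinguishingAdvantage (discretizedGaussian Q α₂) (max (G * (N * m₃)) mfel) (E i) := by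
    rcases hcases with h1 | h2 | h3
    · refine ⟨0, ?_⟩
      show ηstar ≤ distinguishingAdvantage (discretizedGaussian Q α₂) (max (G * (N * m₃)) mfel) (padThen hfM E₁)
      rw [hA₁]; linarith
    · refine ⟨1, ?_⟩
      show ηstar ≤ distinguishingAdvantage (discretizedGaussian Q α₂) (max (G * (N * m₃)) mfel) (raiseThen (discretizedGaussian Q u) (max (G * (N * m₃)) mfel) (padThen hmM E₂))
      linarith
    · refine ⟨2, ?_⟩
      show ηstar ≤ distinguishingAdvantage (discretizedGaussian Q α₂) (max (G * (N * m₃)) mfel) (padThen hfM E₃)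
      rw [hA₃]; linarith
  exact ⟨selectDistinguisher (discretizedGaussian Q α₂) E Nsel,
    distinguishingAdvantage_selectDistinguisher_ge hNsel hηstar hbest⟩

end Close

end BLPRS2013

end Literature.Computability.Cryptography

end
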